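import Mathlib.Analysis.SpecialFunctions.Pow.Real
import HarnessLib

/-!
# The fork at [IUTchIII] Corollary 3.12, III: [IUTchIV] Theorem 1.10 — `C_Θ` as printed

Record-only file (D-0012) of the abc-iut cell's fork skeleton (siblings `ForkDegrees.lean`,
`ForkCopies.lean`, `ForkVojta.lean`, `ForkAbc.lean`); TAKES NO SIDE. It types, for ONE elliptic curve
in initial Θ-data, the real numbers of [IUTchIV] Theorem 1.10 with the constant `C_Θ` exactly as
printed, and the two inputs of Mochizuki's branch of the fork as HYPOTHESES never asserted here:
`MultiradialEstimate` := "`−|log(Θ)| ≤ C_Θ·|log(q)|`" — what Steps (iv)–(xi) of the proof of Thm 1.10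
extract from [IUTchIII] Thm 3.11 WITH the indeterminacies (Ind1), (Ind2), (Ind3) ("(Ind1) and (Ind2)
are taken into account by the arbitrary nature of the automorphism "φ" …, while the indeterminacy
(Ind3) is taken into account by the fact that we are considering upper bounds", Step (v) p. 27) —
and `Cor312` := "`−|log(q)| ≤ −|log(Θ)|`". Proved (pure algebra): together they give `C_Θ ≥ −1`
(`neg_one_le_CTheta`), and `C_Θ ≥ −1` gives the displayed conclusion of Thm 1.10 (`thm110_display`,
for `l ≥ 7`, `d_mod ≥ 1`, checking the printed estimates of the proof's last paragraph, p. 31: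
"`(1 − 12/l²)⁻¹ ≤ 2`; `(1 − 12/l²)⁻¹·(1 + 12·d_mod/l) ≤ 1 + 20·d_mod/l` [cf. the fact that `l ≥ 7`, `d_mod ≥ 1`]").

## What the sources print (read on the page; RIMS manuscript page numbers)

* [IUTchIV] Theorem 1.10, pp. 22–23 [claim: Mochizuki2012, status: disputed]: "`d_mod := [F_mod : ℚ]`,
  `(1 ≤) e_mod (≤ d_mod)` … `d*_mod := 2^{12}·3^3·5·d_mod`, `e*_mod := 2^{12}·3^3·5·e_mod (≤ d*_mod)` …
  [Thus, it follows … that `l ≠ 5`.] … `log(𝔡^{F_tpd}), log(𝔣^{F_tpd}) ∈ ℝ_{≥0}` … `log(q) ∈ ℝ_{≥0}` …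
  the quantity "`|log(q)| ∈ ℝ_{>0}`" defined in [IUTchIII], Corollary 3.12, is equal to `(1/2l)·log(q)`
  … Then one may take the constant "`C_Θ ∈ ℝ`" of [IUTchIII], Corollary 3.12, to be
  `(l+1)/(4·|log(q)|) · { (1 + 12·d_mod/l)·(log(𝔡^{F_tpd}) + log(𝔣^{F_tpd})) + 10·(e*_mod·l + η_prm)
  − (1/6)·(1 − 12/l²)·log(q) } − 1` and hence, by applying the inequality "`C_Θ ≥ −1`" of [IUTchIII],
  Corollary 3.12, conclude that
  `(1/6)·log(q) ≤ (1 + 20·d_mod/l)·(log(𝔡^{F_tpd}) + log(𝔣^{F_tpd})) + 20·(e*_mod·l + η_prm)`"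
  (`η_prm ∈ ℝ_{>0}` the constant of Prop. 1.6; [IUTchI] Def. 3.1 (c): `l ≥ 5` prime).
* [IUTchIII] Corollary 3.12, p. 174 [claim: Mochizuki2012, status: disputed]: "`−|log(Θ)| ∈ ℝ`, and
  `−|log(Θ)| ≥ −|log(q)|` — i.e., `C_Θ ≥ −1` for any real number `C_Θ ∈ ℝ` such that
  `−|log(Θ)| ≤ C_Θ·|log(q)|`."

Cross-validation noticed by the cell's referee (REFEREE-PASS-2 §1): the coefficient step of
`thm110_display` is `0 ≤ t·(8d − 12t − 240dt²)` with `t = 1/l`; it FAILS at `l = 5`, `d_mod = 1`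
(`coeff_step_fails_at_five`) and holds for `l ≥ 7` — the arithmetic independently reproduces the printed
exclusion "`l ≠ 5`" of Theorem 1.10 and the printed "[cf. the fact that `l ≥ 7`, `d_mod ≥ 1`]" of p. 31.

Deliberately NOT here: the construction of initial Θ-data ([IUTchIV] Cor. 2.2), the fields
`F_mod ⊆ F_tpd ⊆ F`, every object upstream of the displayed real numbers; any judgement.
-/

noncomputable section

open Filter Topology

namespace Summit.ABC

namespace IUTFork

/-! ## §1. [IUTchIV] Theorem 1.10: `C_Θ` as printed, and `C_Θ ≥ −1 ⟹` the displayed inequality -/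

/-- The real numbers entering [IUTchIV] Theorem 1.10 for one elliptic curve `E_F` in initial Θ-data.
[claim: Mochizuki2012, status: disputed] -/
structure Thm110Data where
  /-- the prime `l` ([IUTchI] Def. 3.1 (c): `l ≥ 5`; Thm 1.10: `l ≠ 5`; hence `l ≥ 7`) -/
  l : ℕ
  /-- `l ≥ 7` -/
  seven_le_l : 7 ≤ l
  /-- `d_mod = [F_mod : ℚ]` -/
  dmod : ℕ
  /-- `d_mod ≥ 1` -/
  one_le_dmod : 1 ≤ dmod
  /-- `e*_mod = 2^{12}·3^3·5·e_mod` (`e_mod ≥ 1` the maximal ramification index of `F_mod`) -/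
  estar : ℝ
  /-- `e*_mod ≥ 0` (in fact `≥ 2^{12}·3^3·5`) -/
  estar_nonneg : 0 ≤ estar
  /-- `η_prm ∈ ℝ_{>0}`, the constant of [IUTchIV] Prop. 1.6 -/
  eta : ℝ
  /-- `η_prm ≥ 0` -/
  eta_nonneg : 0 ≤ eta
  /-- `log(𝔡^{F_tpd}) + log(𝔣^{F_tpd}) ∈ ℝ_{≥0}` (log-different plus log-conductor) -/
  logdf : ℝ
  /-- nonnegativity, as printed -/
  logdf_nonneg : 0 ≤ logdf
  /-- `log(q) ∈ ℝ_{≥0}`, the degree of the `q`-parameter divisor; `|log(q)| = (1/2l)·log(q) > 0` -/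
  logq : ℝ
  /-- `|log(q)| > 0` ([IUTchIII] Cor. 3.12) -/
  logq_pos : 0 < logq
  /-- `−|log(Θ)| ∈ ℝ` ([IUTchIII] Cor. 3.12: "it holds that `−|log(Θ)| ∈ ℝ`") -/
  negLogTheta : ℝ

namespace Thm110Data

variable (X : Thm110Data)

/-- `|log(q)| = (1/2l)·log(q)`. [claim: Mochizuki2012, status: disputed] -/
def absLogq : ℝ := X.logq / (2 * (X.l : ℝ))

/-- The bracket `{ (1 + 12·d_mod/l)·(log(𝔡) + log(𝔣)) + 10·(e*_mod·l + η_prm) − (1/6)(1 − 12/l²)·log(q) }`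
of the printed `C_Θ`. [claim: Mochizuki2012, status: disputed] -/
def bracket : ℝ :=
  (1 + 12 * (X.dmod : ℝ) / X.l) * X.logdf + 10 * (X.estar * X.l + X.eta)
    - 1 / 6 * (1 - 12 / ((X.l : ℝ) ^ 2)) * X.logq

/-- `C_Θ := (l+1)/(4·|log(q)|) · bracket − 1`, verbatim from [IUTchIV] Theorem 1.10.
[claim: Mochizuki2012, status: disputed] -/
def CTheta : ℝ := ((X.l : ℝ) + 1) / (4 * X.absLogq) * X.bracket - 1

/-- Mochizuki's reading of the fork, as the input it supplies downstream: the multiradial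
representation of [IUTchIII] Thm 3.11 together with the indeterminacies (Ind1), (Ind2), (Ind3) bounds
the Θ-pilot log-volume by `C_Θ·|log(q)|` with the printed `C_Θ` ([IUTchIV] proof of Thm 1.10, Steps
(iv)–(xi): "(Ind1) and (Ind2) are taken into account by the arbitrary nature of the automorphism "φ"
…, while the indeterminacy (Ind3) is taken into account by the fact that we are considering upper
bounds", Step (v) p. 27; Step (viii) p. 30: "we thus obtain the following upper bound for
"`C_Θ·|log(q)|`", i.e., the product of "`C_Θ`" and `(1/2l)·log(q)`: `(l+1)/4 · {…} − (1/2l)·log(q)`",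
whence the printed `C_Θ = (l+1)/(4·|log(q)|)·{…} − 1`). HYPOTHESIS, never asserted here.
[claim: Mochizuki2012, status: disputed] -/
@[claim "Mochizuki2012" "disputed"] def MultiradialEstimate : Prop := X.negLogTheta ≤ X.CTheta * X.absLogq

/-- [IUTchIII] Corollary 3.12 for this curve: `−|log(q)| ≤ −|log(Θ)|`. HYPOTHESIS (the disputed
statement), never asserted here. [claim: Mochizuki2012, status: disputed] -/
@[claim "Mochizuki2012" "disputed"] def Cor312 : Prop := -X.absLogq ≤ X.negLogTheta

/-- The displayed conclusion of [IUTchIV] Theorem 1.10: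
`(1/6)·log(q) ≤ (1 + 20·d_mod/l)·(log(𝔡) + log(𝔣)) + 20·(e*_mod·l + η_prm)`.
[claim: Mochizuki2012, status: disputed] -/
@[claim "Mochizuki2012" "disputed"] def Display : Prop :=
  X.logq / 6 ≤ (1 + 20 * (X.dmod : ℝ) / X.l) * X.logdf + 20 * (X.estar * X.l + X.eta)

/-- `|log(q)| > 0`. [folklore] -/
theorem absLogq_pos : 0 < X.absLogq := by
  have h7 : (7 : ℝ) ≤ X.l := by exact_mod_cast X.seven_le_l
  have := X.logq_pos
  unfold absLogq; positivity

/-- "`C_Θ ≥ −1` for any real number `C_Θ ∈ ℝ` such that `−|log(Θ)| ≤ C_Θ·|log(q)|`" — here for the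
printed `C_Θ`: the multiradial estimate and Cor. 3.12 together give `−1 ≤ C_Θ` (divide by
`|log(q)| > 0`). [claim: Mochizuki2012, status: disputed] -/
theorem neg_one_le_CTheta (h1 : X.MultiradialEstimate) (h2 : X.Cor312) : -1 ≤ X.CTheta := by
  unfold MultiradialEstimate at h1; unfold Cor312 at h2
  have hq := X.absLogq_pos
  have : -X.absLogq ≤ X.CTheta * X.absLogq := le_trans h2 h1
  by_contra hlt
  rw [not_le] at hlt
  have : X.CTheta * X.absLogq < -1 * X.absLogq := mul_lt_mul_of_pos_right hlt hq
  linarith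

/-- `C_Θ ≥ −1` unpacks to `(1/6)(1 − 12/l²)·log(q) ≤ (1 + 12·d_mod/l)(log 𝔡 + log 𝔣) + 10(e*_mod·l + η)`
(the bracket is nonnegative). [folklore] -/
theorem bracket_nonneg_of_neg_one_le_CTheta (h : -1 ≤ X.CTheta) : 0 ≤ X.bracket := by
  unfold CTheta at h
  have hq := X.absLogq_pos
  have h7 : (7 : ℝ) ≤ X.l := by exact_mod_cast X.seven_le_l
  have hc : 0 < ((X.l : ℝ) + 1) / (4 * X.absLogq) := by positivity
  have h0 : 0 ≤ ((X.l : ℝ) + 1) / (4 * X.absLogq) * X.bracket := by linarith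
  by_contra hb
  rw [not_le] at hb
  have : ((X.l : ℝ) + 1) / (4 * X.absLogq) * X.bracket < 0 := mul_neg_of_pos_of_neg hc hb
  linarith

/-- **[IUTchIV] Theorem 1.10, final display, from `C_Θ ≥ −1`** (pure algebra; uses `l ≥ 7`,
`d_mod ≥ 1`, nonnegativity of the log-terms): `(1/6)·log(q) ≤ (1 + 20·d_mod/l)·(log 𝔡 + log 𝔣) +
20·(e*_mod·l + η_prm)`. This kernel-checks the last paragraph of the printed proof (p. 31): "The final
portion of Theorem 1.10 follows immediately from [IUTchIII], Corollary 3.12, by applying … the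
estimates `(1 − 12/l²)⁻¹ ≤ 2`; `(1 − 12/l²)⁻¹·(1 + 12·d_mod/l) ≤ 1 + 20·d_mod/l` [cf. the fact that
`l ≥ 7`, `d_mod ≥ 1`]" — the two coefficient estimates are `hc2`, `hc1` below.
[claim: Mochizuki2012, status: disputed] -/
theorem thm110_display (h : -1 ≤ X.CTheta) : X.Display := by
  have hb := X.bracket_nonneg_of_neg_one_le_CTheta h
  unfold bracket at hb
  unfold Display
  have h7 : (7 : ℝ) ≤ X.l := by exact_mod_cast X.seven_le_l
  have hd : (1 : ℝ) ≤ X.dmod := by exact_mod_cast X.one_le_dmod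
  have hl0 : (0 : ℝ) < X.l := by linarith
  have hL := X.logdf_nonneg
  have hE : 0 ≤ X.estar * X.l + X.eta := by
    have := X.estar_nonneg; have := X.eta_nonneg; positivity
  have hq := X.logq_pos
  -- clear denominators: set t = 1/l, so 12 d/l = 12 d t, 12/l² = 12 t²
  set t : ℝ := 1 / (X.l : ℝ) with ht
  have ht0 : 0 < t := by rw [ht]; positivity
  have ht7 : t ≤ 1 / 7 := by
    rw [ht]; exact one_div_le_one_div_of_le (by norm_num) h7
  have e1 : 12 * (X.dmod : ℝ) / X.l = 12 * X.dmod * t := by rw [ht]; ring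
  have e2 : 12 / ((X.l : ℝ) ^ 2) = 12 * t ^ 2 := by rw [ht]; field_simp
  have e3 : 20 * (X.dmod : ℝ) / X.l = 20 * X.dmod * t := by rw [ht]; ring
  rw [e1, e2] at hb
  rw [e3]
  -- from hb: (1/6)(1 - 12 t²) logq ≤ (1 + 12 d t) L + 10 E
  -- want: logq/6 ≤ (1 + 20 d t) L + 20 E
  -- i.e. logq/6 ≤ [(1+12dt)L + 10E] / (1 - 12t²) ≤ (1+20dt)L + 20E
  have hden : 0 < 1 - 12 * t ^ 2 := by nlinarith
  have hstep : X.logq / 6 * (1 - 12 * t ^ 2) ≤ (1 + 12 * X.dmod * t) * X.logdf +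
      10 * (X.estar * X.l + X.eta) := by linarith
  -- coefficient comparisons
  have hc1 : (1 + 12 * (X.dmod : ℝ) * t) ≤ (1 + 20 * X.dmod * t) * (1 - 12 * t ^ 2) := by
    -- ⟺ 0 ≤ t·(8d − 12t − 240 d t²), true for t ≤ 1/7, d ≥ 1
    have ht2 : t ^ 2 ≤ 1 / 49 := by nlinarith
    have hA : 240 * (X.dmod : ℝ) * t ^ 2 ≤ 240 * X.dmod * (1 / 49) :=
      mul_le_mul_of_nonneg_left ht2 (by positivity)
    have hpos : 0 ≤ 8 * (X.dmod : ℝ) - 12 * t - 240 * X.dmod * t ^ 2 := by linarith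
    have hprod := mul_nonneg (le_of_lt ht0) hpos
    have expand : (1 + 20 * (X.dmod : ℝ) * t) * (1 - 12 * t ^ 2) - (1 + 12 * X.dmod * t) =
        t * (8 * X.dmod - 12 * t - 240 * X.dmod * t ^ 2) := by ring
    linarith
  have hc2 : (10 : ℝ) ≤ 20 * (1 - 12 * t ^ 2) := by nlinarith
  have key : (1 + 12 * (X.dmod : ℝ) * t) * X.logdf + 10 * (X.estar * X.l + X.eta) ≤
      ((1 + 20 * X.dmod * t) * X.logdf + 20 * (X.estar * X.l + X.eta)) * (1 - 12 * t ^ 2) := by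
    have a1 := mul_le_mul_of_nonneg_right hc1 hL
    have a2 := mul_le_mul_of_nonneg_right hc2 hE
    have expand : ((1 + 20 * (X.dmod : ℝ) * t) * X.logdf + 20 * (X.estar * X.l + X.eta)) *
        (1 - 12 * t ^ 2) = (1 + 20 * X.dmod * t) * (1 - 12 * t ^ 2) * X.logdf +
        20 * (1 - 12 * t ^ 2) * (X.estar * X.l + X.eta) := by ring
    rw [expand]
    linarith
  have : X.logq / 6 * (1 - 12 * t ^ 2) ≤
      ((1 + 20 * X.dmod * t) * X.logdf + 20 * (X.estar * X.l + X.eta)) * (1 - 12 * t ^ 2) :=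
    le_trans hstep key
  exact le_of_mul_le_mul_right this hden

/-- The coefficient estimate `(1 − 12/l²)⁻¹·(1 + 12·d_mod/l) ≤ 1 + 20·d_mod/l` of p. 31 — equivalently
`0 ≤ 8d − 12t − 240d·t²`, `t = 1/l` — is FALSE at `l = 5`, `d_mod = 1` (value `−4`): the kernel reproduces
why Theorem 1.10 needs `l ≠ 5`, i.e. `l ≥ 7`. [claim: Mochizuki2012, status: disputed] -/
theorem coeff_step_fails_at_five :
    (8 : ℝ) * 1 - 12 * (1 / 5) - 240 * 1 * (1 / 5) ^ 2 < 0 ∧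
      ¬ ((1 - 12 / (5 : ℝ) ^ 2)⁻¹ * (1 + 12 * 1 / 5) ≤ 1 + 20 * 1 / 5) := by
  constructor <;> norm_num

/-- The per-curve chain as printed: multiradial estimate + Cor. 3.12 ⟹ the display of Thm 1.10.
[claim: Mochizuki2012, status: disputed] -/
theorem display_of_cor312 (h1 : X.MultiradialEstimate) (h2 : X.Cor312) : X.Display :=
  X.thm110_display (X.neg_one_le_CTheta h1 h2)

end Thm110Data

end IUTFork

end Summit.ABC

end
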